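import Literature.Probability.FitznerVanDerHofstad2017.MeanFieldD11Stage1EvalRec
import Literature.Probability.FitznerVanDerHofstad2017.Stage1FrameRem

/-!
# Literature.Probability.FitznerVanDerHofstad2017.MeanFieldD11Stage1EvalRem — R228 (2) at the record cell: the slotted frame at the record reads evaluates to the record's literals

CITATION HEADER (PLACEMENT v2). Part of the certified REPRODUCTION of [FvdH17] / [NoBLE17] (build `lace`, seat lean2 gen 12,
LEMMAS §20 node N68g (g2), REFEREE v41 R228 (2)).  ADDITIVE; no new numeral (the literals are `D11.inputsI/O` of
`MeanFieldD11Inputs`, the tables `CertD11.tabsHi/tabsLo` of `MeanFieldD11Stage1Eval*`); binders of record untouched; no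
dimension sentence, no verdict.

WHAT.  `MeanFieldD11Stage1EvalRec` certifies, by kernel arithmetic, that the cell-44 input record OF RECORD `Data.inpRec` of
any typed frame modelled by the certified tables of the O12g run is dominated at the O12g state by the cited literals
`D11.inputsI/O`, and that its validity conditions hold.  `Stage1FrameRem.inpRm_print'` says the slotted recipe at the record
reads `printSlots` IS the recipe of record.  This file states the composition (R228 (2): "Stage-1 evaluation with
`R = R_print` reproduces the record's literals"): the SLOTTED input record `Data.inpRm (printSlots D.P)` is dominated by the
same literals and satisfies the slotted validity conditions `Data.UAtRm (printSlots D.P)` — for the upper- and the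
lower-endpoint table models.  Nothing is re-validated; the content is `inpRm_print'` + `UAtRm_print`.

[cite: FitznerVanDerHofstad2017, notebook Percolation.nb cell 44 (transcript l.1214–1237); Mathematica notebook output of record (O12g run)]
[cite: FitznerVanDerHofstad2016NoBLE, (5.23)–(5.27) and §5.3.2 p. 1097]
-/

namespace Literature.Probability.FitznerVanDerHofstad2017.Stage1Cells.CertD11Rec

open NoGoFrame CertD11

/-- R228 (2) AT THE RECORD CELL (upper-endpoint tables): the slotted cell-44 record at the record reads is dominated by
the literals of record, both points. [folklore] -/
theorem dom_of_modelHiRem {ν : Type*} (D : Data ν) (hP : D.P = P) (h : D.RatModel dataHi) :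
    (D.inpRm (printSlots D.P) stateRec.cast .i).Dom D11.inputsI ∧ (D.inpRm (printSlots D.P) stateRec.cast .o).Dom D11.inputsO := by
  rw [Data.inpRm_print']; exact dom_of_modelHiRec D hP h

/-- … and the slotted validity conditions at the record reads hold at the O12g stateRec, both points. [folklore] -/
theorem uAtRm_of_modelHiRem {ν : Type*} (D : Data ν) (hP : D.P = P) (h : D.RatModel dataHi) :
    D.UAtRm (printSlots D.P) .i stateRec.cast ∧ D.UAtRm (printSlots D.P) .o stateRec.cast := by
  rw [Data.UAtRm_print, Data.UAtRm_print]; exact uAt_of_modelHiRec D hP h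

/-- the same for a typed frame modelled by the LOWER-endpoint tables. [folklore] -/
theorem dom_of_modelLoRem {ν : Type*} (D : Data ν) (hP : D.P = P) (h : D.RatModel dataLo) :
    (D.inpRm (printSlots D.P) stateRec.cast .i).Dom D11.inputsI ∧ (D.inpRm (printSlots D.P) stateRec.cast .o).Dom D11.inputsO := by
  rw [Data.inpRm_print']; exact dom_of_modelLoRec D hP h

/-- … and its slotted validity conditions. [folklore] -/
theorem uAtRm_of_modelLoRem {ν : Type*} (D : Data ν) (hP : D.P = P) (h : D.RatModel dataLo) :
    D.UAtRm (printSlots D.P) .i stateRec.cast ∧ D.UAtRm (printSlots D.P) .o stateRec.cast := by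
  rw [Data.UAtRm_print, Data.UAtRm_print]; exact uAt_of_modelLoRec D hP h

end Literature.Probability.FitznerVanDerHofstad2017.Stage1Cells.CertD11Rec
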